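import Literature.MathematicalPhysics.QuantumFieldTheory.BalabanImbrieJaffe1984to88.BIJ88Ineq5144PairAdjustmentWitness

/-!
# `BalabanImbrieJaffe1984to88.BIJ88Ineq5144PairGradientWitness` — T. Bałaban, J. Imbrie, A. Jaffe, *Effective action and cluster properties of the
abelian Higgs model*, Commun. Math. Phys. **114** (1988) 257–315 [BalabanImbrieJaffe1988], Sect. 5.14 (5.14.4) p. 309 [PDF 53] with Sect. 5.13 p. 303,
p. 307 [PDF 47, 51]: **THE DECLARED ADJUSTMENT OF `BIJ88Ineq5144TwoCube` IS FORCED AT MODEL LEVEL EVEN WITH THE p. 307 GRADIENT LETTERS** — in the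
§5.13 model the located bound (5.14.4) on a two-cube polymer with print's per-derivative factor `θ` STAYS FALSE when the interaction terms carry, besides
the sup-letter `|V_Y| ≤ K_Y` (p. 303, verbatim: *"We have an estimate |V^{(k)}(Y)| ≦ e^β(L^kε/ε₀)^{1/4−α}. Note that Y contains at most a few cubes."*),
the letters of the p. 307 sentence *"Functional derivatives hitting e^{−V^{(k)}(Y)} yield factors e^β(L^kε/ε₀)^{1/4−α}"* — `V_Y ∈ C²`,
`‖∇V_Y‖ ≤ K′_Y`, `‖∇²V_Y‖ ≤ K″_Y` in the hypothesis shapes of the join engine (p13 `BIJ88WalkFormOrderOne5133.dexp_singleton_walk`: `ContDiff ℝ 2 H`,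
`‖fderiv H‖ ≤ K₁`, `‖fderiv (fderiv H)‖ ≤ K₂`), each worth print's factor: `K′_Y e^{2GK₁} ≤ θ`, `K″_Y e^{2GK₁} ≤ θ`.  This CORRECTS the successor plan
of p36 gen 17 (HOME/HANDOFF.md 2026-08-23T00:30:55Z: *"V-slots NEED NEW LETTERS ‖∇V_Y‖ ≤ K′_Y, ‖∇²V_Y‖ ≤ K″_Y = p.307 sentence — without them the printed
exponent is FALSE"*) and the flip-item wording it induced (r16 ROWS-C2-part2 v2.224/v2.226): the letters do not help; see HOME/GAPS.md G-C2-p36-09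
ADDENDUM 2 (whose PRINT paragraph quotes the same p. 309 bracket since v1.1).

statement-level skeleton of published theorems with citation tags; proofs where landed; nothing here is a claim about the Yang–Mills mass gap

PDF held: `paper:balaban1988-cmp114-bij-abelian-higgs-effective-action` (journal page = PDF page + 256); p. 303 read this generation as an image
(own x2 render of PDF p. 47), pp. 307, 309, 310 on the text layer.  p. 309, verbatim: *"Let us drop the prime, and prove that |g₃(H_β, X_β)| ≦
(e^β(L^kε/ε₀)^{1/4−α})^{[|H_β| + β′|X_β∖H_β|]}. (5.14.4) We use X_β∖H_β to denote the set of cubes with no (d/dt)_{γ_j} factors, j ∈ H_β. … Each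
factor V^{(k)}(Y) in Π (d/dt)_{γ_j} produces a factor e^β(L^kε/ε₀)^{1/4−α} in the final estimate. This is obtained in the Gaussian integration
estimate, using the fact that V^{(k)}(Y) is a small polynomial in A^{(k)}, φ^{(k)}. [The restrictions disappear as t→0, so V^{(k)}(Y) cannot be replaced by its supremum.]"* (v1.1 DOC-ONLY: the bracketed sentence — print's own statement that a supremum letter for V^{(k)}(Y) is not the argument at this step — added to the quotation per referee ref-5 gen 63 D-g63-1; text layer p0053.txt L18–19; declarations byte-identical to v1 p346813.)

WHAT IS PROVED (unit `lit-balaban-p36`, generation 18 of the Phase-2 proof seat p36; HOME/GAPS.md **G-C2-p36-09 ADDENDUM 2**; SKELETON rows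
C2.Eq5.14.3-5.14.4 / C2.Eq5.14.5 of `HOME/lit-balaban-r16/ROWS-C2-part2.md`, owner r16 — informs the wording of the flip item, moves no head).
* §1 the calculus of the witness term `V(φ) = K e^{−φ₀²}` on `Fin 2 → ℝ` (sup norm): `2|x|e^{−x²} ≤ 1`, `|1 − 2x²|e^{−x²} ≤ 1`; `V` is `Cⁿ` for every `n`;
  `fderiv V φ = (−2Kφ₀e^{−φ₀²})·pr₀` (`hasFDerivAt_V`) with **`‖fderiv V φ‖ ≤ K`**; `fderiv (fderiv V) φ = (c ↦ c·pr₀) ∘ ((−2K(1 − 2φ₀²)e^{−φ₀²})·pr₀)`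
  (`hasFDerivAt_fderiv_V`) with **`‖fderiv (fderiv V) φ‖ ≤ 2K`** — the gradient and Hessian letters of the datum are of the SAME size as its sup-letter.
* §2 **`ineq5144_locAct_pair_gradLetters_false`** — the statement refuted in p36 g17 `BIJ88Ineq5144PairAdjustmentWitness.ineq5144_locAct_pair_unadjusted_false`
  ((5.14.4) located on `|X_β| = 2` for any coupling, print's per-derivative factor: `e_k ≤ θ`, `K_Y e^{2GK₁} ≤ θ`) WEAKENED by five further hypotheses —
  `∀ Y, ContDiff ℝ 2 (V Y)`; letters `K′_Y ≥ ‖fderiv (V Y) φ‖`, `K″_Y ≥ ‖fderiv (fderiv (V Y)) φ‖` for all `φ`; clauses `K′_Y e^{2GK₁} ≤ θ`, `K″_Y e^{2GK₁} ≤ θ`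
  — STILL implies `False`.  Witness: the g17 datum with `K = K₁ = K′ = 10⁻⁶`, `K″ = 2·10⁻⁶` (`ℱ = 0`, no χ-slots, ONE interaction term `K e^{−φ₀²}` on cube `0`
  carrying the one `(d/dt)`, cube `1` slot-free, `t = 1`, `θ = 10⁻⁵`, `β′ = 1/2`, `G = m = Λ = 1`, `c₀ = 10`, `F = 0`, `e_k = min(10⁻⁸, 1/(16Ĉ))`): every clause
  holds, the located exponent gives `θ^{3/2} ≤ 3.2·10⁻⁸`, while by `BIJ88PairActivity309.actIn_pair_eq` and g17's `integral_exp_neg_sq_coupled_decoupled` the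
  activity is `⟨−Kve^{−Kv}⟩_coupled − ⟨−Kve^{−Kv}⟩_decoupled ≥ K(e^{−K}·0.707 − 0.6547) > 5·10⁻⁸` (`v = e^{−φ₀²}`).
READING (recorded in GAPS G-C2-p36-09 ADDENDUM 2, not a claim about the paper's correctness): on a pair `{□_i, □_j}` whose only decoration is ONE
`t`-derivative on a term `V(Y) ⊂ □_i`, the p. 307 join (`s`-derivative ⇒ IBP trains `δ/δΦ—C—□_jΔ□_i—C—δ/δΦ`, p13) lets both train ends land on the same
object `V(Y)e^{−tV(Y)}`; the object is then hit three times and, with every letter worth `θ`, contributes `θ¹`, not print's `θ^{1+β′}`.  Print's exponent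
holds in print's regime because `V^{(k)}(Y)` is a polynomial with coefficients far below `θ` (p. 309 *"small polynomial"*; in the model: the V-object must be
worth `θ^{1+β′}` — exactly g17's clause `K_Y e^{2GK₁} ≤ θ^{1+β′}/2`, now known NOT to be removable by the join mechanism with `θ`-worth gradient letters).
HONEST SCOPE: a statement about OUR §5.13 model's hypothesis class; 0 `sorry`, 0 definitions, 0 `Prop` facts (D-0026); imports
`BIJ88Ineq5144PairAdjustmentWitness` (p36 g17: the Gaussian values `√3/√7`, `√4/√8`, `sqrt_window`, `interpForm_id_corner_pair`); modifies nothing.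
NOT summit progress; NOT continuum; NOT Clay.  Cell `lit-balaban` Phase 2, seat p36 gen 18 (owner r16, referee ref-5).
-/

noncomputable section

open Finset MeasureTheory Matrix ProbabilityTheory Filter
open Literature.MathematicalPhysics.QuantumFieldTheory.Balaban1983to89
open B2Eq228Conditioning (weight source)
open Literature.MathematicalPhysics.QuantumFieldTheory.BalabanImbrieJaffe1984to88
open BIJ88Sect2Statements (pLog)
open BIJ88Sect5Statements (CutoffProfile cutoff)
open BIJ88DirichletForms305 (interpForm interpForm_apply)
open BIJ88PolymerRep5134 (corner corner_apply IsConn)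
open BIJ88PolymerRep5134Gauss (ext prec src)
open BIJ88SlotMoments308 (slotFactor slotFactor_inr)
open BIJ88Eq5145CornerModel (slotB slotY regionLaw isProbabilityMeasure_regionLaw)
open BIJ88Eq5145CornerUrsell (cubeIn)
open BIJ88W6PrimeVsupp (actIn)
open BIJ88Ineq5144Located (locAct locAct_of_loc)
open BIJ88GaussIntegration309Product (exists_const_all_orders)
open BIJ88CutoffProfileWitness (gevreyCutoff chi1_nonneg)
open BIJ88PairActivity309 (actIn_pair_eq)
open BIJ88Ineq5144TwoCubeLeaf (fin2Coupling_posDef_and_ge)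
open BIJ88Ineq5144PairAdjustmentWitness (interpForm_id_corner_pair integral_exp_neg_sq_coupled_decoupled sqrt_window)

namespace Literature.MathematicalPhysics.QuantumFieldTheory.BalabanImbrieJaffe1984to88.BIJ88Ineq5144PairGradientWitness

/-! ## §1 The gradient and Hessian letters of the witness term `V(φ) = K e^{−φ₀²}` -/
section Calculus

/-- `2|x|e^{−x²} ≤ 1` (`e^{x²} ≥ 1 + x² ≥ 2|x|`). [cite: BalabanImbrieJaffe1988, p.307 (Sect. 5.13)] -/
theorem two_mul_abs_mul_exp_neg_sq_le_one (x : ℝ) : 2 * |x| * Real.exp (-x ^ 2) ≤ 1 := by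
  have h1 : 2 * |x| ≤ Real.exp (x ^ 2) := by
    have h := Real.add_one_le_exp (x ^ 2)
    have habs : |x| ^ 2 = x ^ 2 := sq_abs x
    nlinarith [sq_nonneg (|x| - 1), abs_nonneg x]
  rw [Real.exp_neg, ← div_eq_mul_inv, div_le_one (Real.exp_pos _)]
  exact h1

/-- `|1 − 2x²|e^{−x²} ≤ 1` (`e^{x²} ≥ 1 + x² + x⁴/2 ≥ 2x² − 1`). [cite: BalabanImbrieJaffe1988, p.307 (Sect. 5.13)] -/
theorem abs_one_sub_two_mul_sq_mul_exp_neg_sq_le_one (x : ℝ) : |1 - 2 * x ^ 2| * Real.exp (-x ^ 2) ≤ 1 := by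
  rw [Real.exp_neg, ← div_eq_mul_inv, div_le_one (Real.exp_pos _)]
  have h := Real.quadratic_le_exp_of_nonneg (sq_nonneg x)
  rcases le_or_gt (2 * x ^ 2) 1 with h1 | h1
  · rw [abs_of_nonneg (by linarith)]
    have := Real.add_one_le_exp (x ^ 2)
    nlinarith [sq_nonneg x]
  · rw [abs_of_neg (by linarith)]
    nlinarith [sq_nonneg (x ^ 2)]

variable (K : ℝ)

/-- the coordinate projection `pr₀ : (Fin 2 → ℝ) →L ℝ`, of operator norm `≤ 1` for the sup norm. [cite: BalabanImbrieJaffe1988, p.307 (Sect. 5.13)] -/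
theorem norm_proj0_le : ‖(ContinuousLinearMap.proj (R := ℝ) (φ := fun _ : Fin 2 => ℝ) 0 : (Fin 2 → ℝ) →L[ℝ] ℝ)‖ ≤ 1 :=
  ContinuousLinearMap.opNorm_le_bound _ zero_le_one fun v => by rw [one_mul]; exact norm_le_pi_norm v 0

/-- `d/dy (−y²) = −2y`. [cite: BalabanImbrieJaffe1988, p.307 (Sect. 5.13)] -/
theorem hasDerivAt_negSq (x : ℝ) : HasDerivAt (fun y : ℝ => -y ^ 2) (-(2 * x)) x :=
  (show HasDerivAt (fun y : ℝ => y ^ 2) (2 * x) x by simpa using hasDerivAt_pow 2 x).neg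

/-- `d/dx (K e^{−x²}) = −2Kxe^{−x²}`. [cite: BalabanImbrieJaffe1988, p.307 (Sect. 5.13)] -/
theorem hasDerivAt_gauss0 (x : ℝ) : HasDerivAt (fun y => K * Real.exp (-y ^ 2)) (-2 * K * x * Real.exp (-x ^ 2)) x :=
  (((hasDerivAt_negSq x).exp).const_mul K).congr_deriv (by ring)

/-- `d/dx (−2Kxe^{−x²}) = −2K(1 − 2x²)e^{−x²}`. [cite: BalabanImbrieJaffe1988, p.307 (Sect. 5.13)] -/
theorem hasDerivAt_gauss1 (x : ℝ) :
    HasDerivAt (fun y => -2 * K * y * Real.exp (-y ^ 2)) (-2 * K * (1 - 2 * x ^ 2) * Real.exp (-x ^ 2)) x := by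
  have hx : HasDerivAt (fun y : ℝ => -2 * K * y) (-2 * K) x := by simpa using (hasDerivAt_id x).const_mul (-2 * K)
  exact (hx.mul (hasDerivAt_negSq x).exp).congr_deriv (by ring)

/-- **the gradient of the witness term**: `fderiv (K e^{−φ₀²}) φ = (−2Kφ₀e^{−φ₀²})·pr₀`. [cite: BalabanImbrieJaffe1988, p.307 (Sect. 5.13)] -/
theorem hasFDerivAt_V (φ : Fin 2 → ℝ) :
    HasFDerivAt (fun ψ : Fin 2 → ℝ => K * Real.exp (-(ψ 0) ^ 2))
      ((-2 * K * φ 0 * Real.exp (-(φ 0) ^ 2)) • (ContinuousLinearMap.proj (R := ℝ) (φ := fun _ : Fin 2 => ℝ) 0 : (Fin 2 → ℝ) →L[ℝ] ℝ)) φ :=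
  HasDerivAt.comp_hasFDerivAt (h₂ := fun y => K * Real.exp (-y ^ 2)) φ (hasDerivAt_gauss0 K (φ 0))
    ((ContinuousLinearMap.proj (R := ℝ) (φ := fun _ : Fin 2 => ℝ) 0 : (Fin 2 → ℝ) →L[ℝ] ℝ).hasFDerivAt)

/-- the gradient as a function of the field. [cite: BalabanImbrieJaffe1988, p.307 (Sect. 5.13)] -/
theorem fderiv_V_eq : fderiv ℝ (fun ψ : Fin 2 → ℝ => K * Real.exp (-(ψ 0) ^ 2)) =
    fun φ => (-2 * K * φ 0 * Real.exp (-(φ 0) ^ 2)) • (ContinuousLinearMap.proj (R := ℝ) (φ := fun _ : Fin 2 => ℝ) 0 : (Fin 2 → ℝ) →L[ℝ] ℝ) := by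
  funext φ; exact (hasFDerivAt_V K φ).fderiv

/-- **the gradient letter of the witness term is its sup-letter**: `‖fderiv (K e^{−φ₀²}) φ‖ ≤ K` (`K ≥ 0`, sup norm on `Fin 2 → ℝ`).
[cite: BalabanImbrieJaffe1988, p.307 (Sect. 5.13)] -/
theorem norm_fderiv_V_le (hK : 0 ≤ K) (φ : Fin 2 → ℝ) : ‖fderiv ℝ (fun ψ : Fin 2 → ℝ => K * Real.exp (-(ψ 0) ^ 2)) φ‖ ≤ K := by
  rw [fderiv_V_eq]
  show ‖(-2 * K * φ 0 * Real.exp (-(φ 0) ^ 2)) • (ContinuousLinearMap.proj (R := ℝ) (φ := fun _ : Fin 2 => ℝ) 0 : (Fin 2 → ℝ) →L[ℝ] ℝ)‖ ≤ K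
  rw [norm_smul, Real.norm_eq_abs, show -2 * K * φ 0 * Real.exp (-(φ 0) ^ 2) = -(K * (2 * φ 0 * Real.exp (-(φ 0) ^ 2))) by ring, abs_neg,
    abs_mul, abs_of_nonneg hK, abs_mul, abs_mul, abs_of_pos (Real.exp_pos _), abs_two]
  calc K * (2 * |φ 0| * Real.exp (-(φ 0) ^ 2)) * ‖(ContinuousLinearMap.proj (R := ℝ) (φ := fun _ : Fin 2 => ℝ) 0 : (Fin 2 → ℝ) →L[ℝ] ℝ)‖
      ≤ K * 1 * 1 := mul_le_mul (mul_le_mul_of_nonneg_left (two_mul_abs_mul_exp_neg_sq_le_one _) hK) norm_proj0_le (norm_nonneg _)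
        (mul_nonneg hK zero_le_one)
    _ = K := by ring

/-- **the Hessian of the witness term**: `fderiv (fderiv (K e^{−φ₀²})) φ = (c ↦ c·pr₀) ∘ ((−2K(1 − 2φ₀²)e^{−φ₀²})·pr₀)`.
[cite: BalabanImbrieJaffe1988, p.307 (Sect. 5.13)] -/
theorem hasFDerivAt_fderiv_V (φ : Fin 2 → ℝ) :
    HasFDerivAt (fderiv ℝ (fun ψ : Fin 2 → ℝ => K * Real.exp (-(ψ 0) ^ 2)))
      ((ContinuousLinearMap.smulRight (ContinuousLinearMap.id ℝ ℝ)
          (ContinuousLinearMap.proj (R := ℝ) (φ := fun _ : Fin 2 => ℝ) 0 : (Fin 2 → ℝ) →L[ℝ] ℝ) : ℝ →L[ℝ] ((Fin 2 → ℝ) →L[ℝ] ℝ)).comp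
        ((-2 * K * (1 - 2 * (φ 0) ^ 2) * Real.exp (-(φ 0) ^ 2)) •
          (ContinuousLinearMap.proj (R := ℝ) (φ := fun _ : Fin 2 => ℝ) 0 : (Fin 2 → ℝ) →L[ℝ] ℝ))) φ := by
  set P : (Fin 2 → ℝ) →L[ℝ] ℝ := ContinuousLinearMap.proj (R := ℝ) (φ := fun _ : Fin 2 => ℝ) 0 with hP
  set SP : ℝ →L[ℝ] ((Fin 2 → ℝ) →L[ℝ] ℝ) := ContinuousLinearMap.smulRight (ContinuousLinearMap.id ℝ ℝ) P with hSP
  rw [fderiv_V_eq]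
  have hg : HasFDerivAt ((fun y => -2 * K * y * Real.exp (-y ^ 2)) ∘ fun ψ : Fin 2 → ℝ => ψ 0)
      ((-2 * K * (1 - 2 * (φ 0) ^ 2) * Real.exp (-(φ 0) ^ 2)) • P) φ :=
    HasDerivAt.comp_hasFDerivAt (h₂ := fun y => -2 * K * y * Real.exp (-y ^ 2)) φ (hasDerivAt_gauss1 K (φ 0)) P.hasFDerivAt
  have h := (SP.hasFDerivAt (x := ((fun y => -2 * K * y * Real.exp (-y ^ 2)) ∘ fun ψ : Fin 2 → ℝ => ψ 0) φ)).comp φ hg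
  have e : (fun φ : Fin 2 → ℝ => (-2 * K * φ 0 * Real.exp (-(φ 0) ^ 2)) • P) =
      (fun c : ℝ => SP c) ∘ ((fun y => -2 * K * y * Real.exp (-y ^ 2)) ∘ fun ψ : Fin 2 → ℝ => ψ 0) := by
    funext ψ
    simp only [Function.comp_apply, hSP, ContinuousLinearMap.smulRight_apply, ContinuousLinearMap.id_apply]
  rw [e]
  exact h

/-- **the Hessian letter of the witness term is twice its sup-letter**: `‖fderiv (fderiv (K e^{−φ₀²})) φ‖ ≤ 2K` (`K ≥ 0`).
[cite: BalabanImbrieJaffe1988, p.307 (Sect. 5.13)] -/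
theorem norm_fderiv_fderiv_V_le (hK : 0 ≤ K) (φ : Fin 2 → ℝ) :
    ‖fderiv ℝ (fderiv ℝ (fun ψ : Fin 2 → ℝ => K * Real.exp (-(ψ 0) ^ 2))) φ‖ ≤ 2 * K := by
  rw [(hasFDerivAt_fderiv_V K φ).fderiv]
  refine (ContinuousLinearMap.opNorm_comp_le _ _).trans ?_
  have hSP : ‖(ContinuousLinearMap.smulRight (ContinuousLinearMap.id ℝ ℝ)
      (ContinuousLinearMap.proj (R := ℝ) (φ := fun _ : Fin 2 => ℝ) 0 : (Fin 2 → ℝ) →L[ℝ] ℝ) : ℝ →L[ℝ] ((Fin 2 → ℝ) →L[ℝ] ℝ))‖ ≤ 1 := by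
    rw [ContinuousLinearMap.norm_smulRight_apply]
    calc ‖ContinuousLinearMap.id ℝ ℝ‖ * ‖(ContinuousLinearMap.proj (R := ℝ) (φ := fun _ : Fin 2 => ℝ) 0 : (Fin 2 → ℝ) →L[ℝ] ℝ)‖ ≤ 1 * 1 :=
          mul_le_mul ContinuousLinearMap.norm_id_le norm_proj0_le (norm_nonneg _) zero_le_one
      _ = 1 := one_mul 1
  have h2 : ‖(-2 * K * (1 - 2 * (φ 0) ^ 2) * Real.exp (-(φ 0) ^ 2)) •
      (ContinuousLinearMap.proj (R := ℝ) (φ := fun _ : Fin 2 => ℝ) 0 : (Fin 2 → ℝ) →L[ℝ] ℝ)‖ ≤ 2 * K := by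
    rw [norm_smul, Real.norm_eq_abs, show -2 * K * (1 - 2 * (φ 0) ^ 2) * Real.exp (-(φ 0) ^ 2) =
      -(2 * K * ((1 - 2 * (φ 0) ^ 2) * Real.exp (-(φ 0) ^ 2))) by ring, abs_neg, abs_mul, abs_of_nonneg (by positivity : (0 : ℝ) ≤ 2 * K),
      abs_mul, abs_of_pos (Real.exp_pos _)]
    calc 2 * K * (|1 - 2 * (φ 0) ^ 2| * Real.exp (-(φ 0) ^ 2)) * ‖(ContinuousLinearMap.proj (R := ℝ) (φ := fun _ : Fin 2 => ℝ) 0 : (Fin 2 → ℝ) →L[ℝ] ℝ)‖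
        ≤ 2 * K * 1 * 1 := mul_le_mul (mul_le_mul_of_nonneg_left (abs_one_sub_two_mul_sq_mul_exp_neg_sq_le_one _) (by positivity))
          norm_proj0_le (norm_nonneg _) (by positivity)
      _ = 2 * K := by ring
  calc _ ≤ 1 * (2 * K) := mul_le_mul hSP h2 (norm_nonneg _) zero_le_one
    _ = 2 * K := one_mul _

/-- the witness term is smooth. [cite: BalabanImbrieJaffe1988, p.307 (Sect. 5.13)] -/
theorem contDiff_V (n : ℕ∞) : ContDiff ℝ n (fun ψ : Fin 2 → ℝ => K * Real.exp (-(ψ 0) ^ 2)) := by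
  fun_prop

end Calculus

/-! ## §2 (5.14.4) on a two-cube polymer with print's per-derivative factor `θ` FAILS even with the p. 307 gradient letters -/
section Main
set_option maxHeartbeats 400000 in
/-- **NO-GO WITH GRADIENT LETTERS: (5.14.4) located on a two-cube polymer with print's per-derivative factor `θ` is FALSE in the §5.13 model even when
every interaction term is `C²` with gradient and Hessian letters worth `θ`** — the statement refuted by g17's `ineq5144_locAct_pair_unadjusted_false`
(that of `BIJ88Ineq5144TwoCube.ineq5144_locAct_pair_of_struct` with `e_k ≤ θ`, `K_Y e^{2GK₁} ≤ θ` in place of the declared `θ^{1+β′}/2`) with FIVE MORE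
HYPOTHESES — `ContDiff ℝ 2 (V Y)`; `‖fderiv (V Y) φ‖ ≤ K′_Y`, `‖fderiv (fderiv (V Y)) φ‖ ≤ K″_Y` (the shapes of p13's `dexp_singleton_walk`); `K′_Y e^{2GK₁} ≤ θ`,
`K″_Y e^{2GK₁} ≤ θ` (p. 307: *"Functional derivatives hitting e^{−V^{(k)}(Y)} yield factors e^β(L^kε/ε₀)^{1/4−α}"*, one letter per derivative, each worth
`θ`) — implies `False`.  Witness: `V = K e^{−φ₀²}` on cube `0` of the g17 datum (gradient `≤ K`, Hessian `≤ 2K` by §1), `K = K₁ = K′ = 10⁻⁶`, `K″ = 2·10⁻⁶`,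
`θ = 10⁻⁵`, `β′ = 1/2`, `t = G = m = Λ = 1`, `c₀ = 10`, `F = 0`, `e_k = min(10⁻⁸, 1/(16Ĉ))`: exponent side `θ^{3/2} ≤ 3.2·10⁻⁸`, activity
`≥ K(e^{−K}·0.707 − 0.6547) > 5·10⁻⁸`.  At model level print's exponent on a pair needs the V-OBJECT to be worth `θ^{1+β′}` (g17's declared clause), which
p. 309's *"V^{(k)}(Y) is a small polynomial"* supplies in print's regime and p. 303's stated `|V^{(k)}(Y)| ≦ θ` does not (HOME/GAPS.md G-C2-p36-09 ADDENDUM 2) — print, same sentence of p. 309: *"[The restrictions disappear as t→0, so V^{(k)}(Y) cannot be replaced by its supremum.]"*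
[cite: BalabanImbrieJaffe1988, (5.14.4) p.309; p.307 (Sect. 5.13); p.303 (Sect. 5.13)] -/
theorem ineq5144_locAct_pair_gradLetters_false :
    ¬ (∀ (α I : Type) [Fintype α] [DecidableEq α] [Fintype I] [DecidableEq I] (blk : α → I) (Δ : Matrix α α ℝ) (ℱ : α → ℝ)
        (adj : I → I → Prop) [DecidableRel adj] (χ : CutoffProfile) (ι υ : Type) [Fintype ι] [DecidableEq ι] [Fintype υ] [DecidableEq υ]
        (p ek : ℝ) (B : Finset ι) (Φ : ι → (α → ℝ) → ℝ) (c : ι → ℝ) (Ys : Finset υ) (V : υ → (α → ℝ) → ℝ) (cube : ↥B ⊕ ↥Ys → I)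
        (n₀ : ℕ) (C : ℝ), 1 / 2 < p → 1 ≤ C →
        (∀ i, i ≤ n₀ → ∀ (A : ℝ) ⦃q e t : ℝ⦄, q ≠ 0 → 0 < e → 0 < t → t * e ≤ Real.exp (-1) →
          |iteratedDeriv i (fun s => cutoff χ (q * pLog p (s * e)) A) t| ≤ C * t ^ (-(i : ℤ))) →
        Δ.PosDef → ∀ (m : ℝ), 0 < m → (∀ φ : α → ℝ, m * (φ ⬝ᵥ φ) ≤ φ ⬝ᵥ (Δ *ᵥ φ)) → (∀ x, 0 ≤ χ.χ₁ x) →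
        ∀ (c₀ : ℝ), 0 < c₀ → (∀ b ∈ B, c₀ ≤ c b) → ∀ (Λ : ℝ), 0 < Λ →
        (∀ b ∈ B, ∃ ℓ₁ ℓ₂ : (α → ℝ) → ℝ, IsLinearMap ℝ ℓ₁ ∧ IsLinearMap ℝ ℓ₂ ∧
          ((∀ φ, Φ b φ = ℓ₁ φ) ∨ (∀ φ, Φ b φ = Real.sqrt (ℓ₁ φ ^ 2 + ℓ₂ φ ^ 2))) ∧
          (∀ φ, |ℓ₁ φ| ≤ Λ * Real.sqrt (φ ⬝ᵥ φ)) ∧ (∀ φ, |ℓ₂ φ| ≤ Λ * Real.sqrt (φ ⬝ᵥ φ))) →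
        ∀ (F : ℝ), 0 ≤ F → (∀ i : I, src blk ℱ {i} ⬝ᵥ src blk ℱ {i} ≤ F ^ 2) → (∀ Y ∈ Ys, Measurable (V Y)) →
        -- the p. 307 letters: `C²` interaction terms with gradient and Hessian letters
        (∀ Y ∈ Ys, ContDiff ℝ 2 (V Y)) →
        ∀ (KY' : υ → ℝ), (∀ Y ∈ Ys, ∀ φ, ‖fderiv ℝ (V Y) φ‖ ≤ KY' Y) →
        ∀ (KY'' : υ → ℝ), (∀ Y ∈ Ys, ∀ φ, ‖fderiv ℝ (fderiv ℝ (V Y)) φ‖ ≤ KY'' Y) →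
        ∀ (KY : υ → ℝ), (∀ Y ∈ Ys, ∀ φ, |V Y φ| ≤ KY Y) → ∀ (K₁ : ℝ), 0 ≤ K₁ → (∀ Y ∈ Ys, KY Y ≤ K₁) →
        ∀ (G : ℕ), (∀ i, (univ.filter fun τ : ↥B ⊕ ↥Ys => cube τ = i).card ≤ G) → 0 < ek → ek ≤ Real.exp (-1) →
        ∀ (θ β' : ℝ), 0 < θ → θ ≤ 1 → 0 ≤ β' →
        ((n₀ : ℝ) + 1 ≤ m / (8 * Λ ^ 2) * (81 / 100) * c₀ ^ 2 * Real.log ek⁻¹ ^ (2 * p - 1)) →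
        (C ^ n₀ * (4 * Real.exp (F ^ 2 / m)) * Real.exp (2 * G * K₁) * ek ≤ 1) →
        (Real.exp (2 * G * K₁) * (2 * G) * (4 * Real.exp (F ^ 2 / m)) * ek + (Real.exp (2 * G * K₁) - 1) ≤ θ ^ (2 * β') / 2) →
        ek ≤ θ → (∀ Y ∈ Ys, KY Y * Real.exp (2 * G * K₁) ≤ θ) →
        -- the gradient letters worth print's per-derivative factor
        (∀ Y ∈ Ys, KY' Y * Real.exp (2 * G * K₁) ≤ θ) → (∀ Y ∈ Ys, KY'' Y * Real.exp (2 * G * K₁) ≤ θ) →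
        ∀ (Λc X : Finset I) (t : ℝ), t ∈ Set.Ioc (0 : ℝ) 1 → ∀ (L : Type) [Fintype L] [DecidableEq L], Fintype.card L ≤ n₀ →
        ∀ (γ : L → ↥(slotB B Ys cube X) ⊕ ↥(slotY B Ys cube X)) (H : Finset L) (X₂ : Finset I), X₂.card = 2 →
        |locAct (cubeIn cube X ∘ γ) (actIn blk Δ ℱ adj χ p ek B Φ c Ys V cube Λc X t γ) H X₂| ≤
          θ ^ ((H.card : ℝ) + β' * ((X₂ \ H.image (cubeIn cube X ∘ γ)).card : ℝ))) := by
  intro h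
  classical
  obtain ⟨C, hC1, hC⟩ := exists_const_all_orders gevreyCutoff 1 1
  obtain ⟨hΔ, hΔm⟩ := fin2Coupling_posDef_and_ge
  have hmem : ∀ z : Fin 2, z ∈ ({0, 1} : Finset (Fin 2)) := by decide
  -- the constants
  have hC0 : 0 < C := by linarith
  set K : ℝ := 1 / 10 ^ 6 with hK
  set θ : ℝ := 1 / 10 ^ 5 with hθ
  set ek : ℝ := min (1 / 10 ^ 8) (1 / (16 * C)) with hekdef
  obtain ⟨hK0, hθ0, hθ1⟩ : 0 < K ∧ 0 < θ ∧ θ ≤ 1 := by rw [hK, hθ]; norm_num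
  have hek0 : 0 < ek := lt_min (by norm_num) (by positivity)
  have hek8 : ek ≤ 1 / 10 ^ 8 := min_le_left _ _; have hekC : ek ≤ 1 / (16 * C) := min_le_right _ _
  have he3 : Real.exp 1 < 3 := lt_trans Real.exp_one_lt_d9 (by norm_num)
  have hek1 : ek ≤ Real.exp (-1) := le_trans (by linarith) (show (1 : ℝ) / 3 ≤ Real.exp (-1) by
    rw [Real.exp_neg, inv_eq_one_div]; exact one_div_le_one_div_of_le (Real.exp_pos 1) he3.le)
  have heK : Real.exp (2 * ((1 : ℕ) : ℝ) * K) ≤ 3 := le_trans (Real.exp_le_exp.2 (by rw [hK]; norm_num)) he3.le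
  have heK' : Real.exp (2 * ((1 : ℕ) : ℝ) * K) - 1 ≤ 2 * K + (2 * K) ^ 2 := by
    have h2 := (abs_le.1 (Real.abs_exp_sub_one_sub_id_le (show |2 * K| ≤ 1 by rw [abs_of_pos (by positivity), hK]; norm_num))).2
    rw [show 2 * ((1 : ℕ) : ℝ) * K = 2 * K by simp]; linarith
  -- the datum: no χ-slots, one interaction term on cube 0
  let cube₀ : ↥(∅ : Finset Unit) ⊕ ↥(univ : Finset Unit) → Fin 2 := fun _ => 0
  have hY0 : (⟨(), mem_univ _⟩ : ↥(univ : Finset Unit)) ∈ slotY (∅ : Finset Unit) (univ : Finset Unit) cube₀ ({0, 1} : Finset (Fin 2)) :=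
    mem_filter.2 ⟨mem_univ _, hmem _⟩
  let γ₀ : Unit → ↥(slotB (∅ : Finset Unit) (univ : Finset Unit) cube₀ ({0, 1} : Finset (Fin 2))) ⊕
      ↥(slotY (∅ : Finset Unit) (univ : Finset Unit) cube₀ ({0, 1} : Finset (Fin 2))) := fun _ => Sum.inr ⟨_, hY0⟩
  have hF : ∀ i : Fin 2, src (id : Fin 2 → Fin 2) (0 : Fin 2 → ℝ) {i} ⬝ᵥ src (id : Fin 2 → Fin 2) (0 : Fin 2 → ℝ) {i} ≤ (0 : ℝ) ^ 2 :=
    fun i => by simp [BIJ88PolymerRep5134Gauss.src, dotProduct]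
  have hVm : Measurable fun φ : Fin 2 → ℝ => K * Real.exp (-(φ 0) ^ 2) := Continuous.measurable (by fun_prop)
  have hVb : ∀ φ : Fin 2 → ℝ, |K * Real.exp (-(φ 0) ^ 2)| ≤ K := fun φ => by
    rw [abs_of_nonneg (by positivity)]
    exact mul_le_of_le_one_right hK0.le (Real.exp_le_one_iff.2 (neg_nonpos.2 (sq_nonneg _)))
  -- the p. 307 letters of the datum (§1): `C²`, gradient `≤ K`, Hessian `≤ 2K`
  have hVC : ContDiff ℝ 2 fun φ : Fin 2 → ℝ => K * Real.exp (-(φ 0) ^ 2) := contDiff_V K 2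
  have hV1 : ∀ φ : Fin 2 → ℝ, ‖fderiv ℝ (fun ψ : Fin 2 → ℝ => K * Real.exp (-(ψ 0) ^ 2)) φ‖ ≤ K := norm_fderiv_V_le K hK0.le
  have hV2 : ∀ φ : Fin 2 → ℝ, ‖fderiv ℝ (fderiv ℝ (fun ψ : Fin 2 → ℝ => K * Real.exp (-(ψ 0) ^ 2))) φ‖ ≤ 2 * K :=
    norm_fderiv_fderiv_V_le K hK0.le
  have hG : ∀ i : Fin 2, (univ.filter fun τ : ↥(∅ : Finset Unit) ⊕ ↥(univ : Finset Unit) => cube₀ τ = i).card ≤ 1 := fun i =>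
    (card_le_univ _).trans (by simp)
  -- the regime inequalities of the statement with print's per-derivative factor, letters included
  have hreg : (((1 : ℕ) : ℝ) + 1 ≤ 1 / (8 * (1 : ℝ) ^ 2) * (81 / 100) * (10 : ℝ) ^ 2 * Real.log ek⁻¹ ^ (2 * (1 : ℝ) - 1)) := by
    have hinv : (10 : ℝ) ^ 8 ≤ ek⁻¹ := by rw [le_inv_comm₀ (by positivity) hek0]; rw [one_div] at hek8; exact hek8
    have hlog : 1 ≤ Real.log ek⁻¹ := by rw [Real.le_log_iff_exp_le (inv_pos.2 hek0)]; linarith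
    rw [show (2 : ℝ) * 1 - 1 = 1 by norm_num, Real.rpow_one, show (1 : ℝ) / (8 * 1 ^ 2) * (81 / 100) * 10 ^ 2 = 81 / 8 by norm_num,
      Nat.cast_one]
    linarith
  have hpre₂ : C ^ 1 * (4 * Real.exp ((0 : ℝ) ^ 2 / 1)) * Real.exp (2 * ((1 : ℕ) : ℝ) * K) * ek ≤ 1 := by
    have h1 : C ^ 1 * (4 * Real.exp ((0 : ℝ) ^ 2 / 1)) * Real.exp (2 * ((1 : ℕ) : ℝ) * K) * ek ≤ C * 4 * 3 * (1 / (16 * C)) := by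
      rw [pow_one, show Real.exp ((0 : ℝ) ^ 2 / 1) = 1 by simp, mul_one]
      gcongr
    have h2 : C * 4 * 3 * (1 / (16 * C)) = 3 / 4 := by field_simp; ring
    linarith
  have hvac₂ : Real.exp (2 * ((1 : ℕ) : ℝ) * K) * (2 * ((1 : ℕ) : ℝ)) * (4 * Real.exp ((0 : ℝ) ^ 2 / 1)) * ek +
      (Real.exp (2 * ((1 : ℕ) : ℝ) * K) - 1) ≤ θ ^ (2 * (1 / 2 : ℝ)) / 2 := by
    have h0 : Real.exp ((0 : ℝ) ^ 2 / 1) = 1 := by simp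
    rw [h0, mul_one, show (2 : ℝ) * (1 / 2) = 1 by norm_num, Real.rpow_one]
    have h1 : Real.exp (2 * ((1 : ℕ) : ℝ) * K) * (2 * ((1 : ℕ) : ℝ)) * 4 * ek ≤ 3 * (2 * 1) * 4 * (1 / 10 ^ 8) := by gcongr; simp
    rw [hθ, hK] at *
    nlinarith
  have hekθ : ek ≤ θ := by rw [hθ]; linarith
  have hKθ : ∀ Y ∈ (univ : Finset Unit), K * Real.exp (2 * ((1 : ℕ) : ℝ) * K) ≤ θ := fun _ _ => by
    calc K * Real.exp (2 * ((1 : ℕ) : ℝ) * K) ≤ K * 3 := by gcongr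
      _ ≤ θ := by rw [hK, hθ]; norm_num
  have hK2θ : ∀ Y ∈ (univ : Finset Unit), 2 * K * Real.exp (2 * ((1 : ℕ) : ℝ) * K) ≤ θ := fun _ _ => by
    calc 2 * K * Real.exp (2 * ((1 : ℕ) : ℝ) * K) ≤ 2 * K * 3 := by gcongr
      _ ≤ θ := by rw [hK, hθ]; norm_num
  -- the statement on the datum
  have hmain := h (Fin 2) (Fin 2) id (!![2, 1; 1, 2]) 0 (fun x y => x ≠ y) gevreyCutoff Unit Unit 1 ek ∅ (fun _ _ => 0) (fun _ => 1) univ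
    (fun _ φ => K * Real.exp (-(φ 0) ^ 2)) cube₀ 1 C (by norm_num) hC1 hC hΔ 1 one_pos hΔm chi1_nonneg 10 (by norm_num)
    (fun b hb => absurd hb (notMem_empty _)) 1 one_pos (fun b hb => absurd hb (notMem_empty _)) 0 le_rfl hF (fun _ _ => hVm)
    (fun _ _ => hVC) (fun _ => K) (fun _ _ φ => hV1 φ) (fun _ => 2 * K) (fun _ _ φ => hV2 φ) (fun _ => K)
    (fun _ _ φ => hVb φ) K hK0.le (fun _ _ => le_rfl) 1 hG hek0 hek1 θ (1 / 2) hθ0 hθ1 (by norm_num) hreg hpre₂ hvac₂ hekθ hKθ hKθ hK2θ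
    {0, 1} {0, 1} 1 ⟨one_pos, le_rfl⟩ Unit (by simp) γ₀ univ {0, 1} (card_pair (show (0 : Fin 2) ≠ 1 by decide))
  -- evaluate the located activity of the pair: coupled minus decoupled expectation of the one differentiated slot
  have hconn : IsConn (fun x y : Fin 2 => x ≠ y) ({0, 1} : Finset (Fin 2)) := by decide
  have hT : (univ.filter fun τ : ↥(slotB (∅ : Finset Unit) (univ : Finset Unit) cube₀ ({0, 1} : Finset (Fin 2))) ⊕
      ↥(slotY (∅ : Finset Unit) (univ : Finset Unit) cube₀ ({0, 1} : Finset (Fin 2))) =>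
        cubeIn cube₀ ({0, 1} : Finset (Fin 2)) τ ∈ ({0, 1} : Finset (Fin 2))) = {Sum.inr ⟨_, hY0⟩} := by
    ext τ
    simp only [mem_filter, mem_univ, true_and, mem_singleton]
    refine ⟨fun _ => ?_, fun _ => hmem _⟩
    rcases τ with ⟨⟨b, hb⟩, _⟩ | ⟨⟨u, hu⟩, hY⟩
    · exact absurd hb (notMem_empty _)
    · rfl
  have hcard : (univ.filter fun l : Unit => γ₀ l = Sum.inr ⟨_, hY0⟩).card = 1 := by
    rw [filter_true_of_mem fun l _ => rfl, card_univ, Fintype.card_unit]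
  have hext : ∀ ω : BIJ88PolymerRep5134Gauss.Site (id : Fin 2 → Fin 2) ({0, 1} : Finset (Fin 2)) → ℝ,
      ext (id : Fin 2 → Fin 2) ({0, 1} : Finset (Fin 2)) ω 0 = ω ⟨0, hmem 0⟩ := fun ω => by simp [BIJ88PolymerRep5134Gauss.ext]
  have hderiv : ∀ a : ℝ, deriv (fun s : ℝ => Real.exp (-(s * a))) 1 = -(a * Real.exp (-a)) := fun a => by
    have hd : HasDerivAt (fun s : ℝ => Real.exp (-(s * a))) (Real.exp (-(1 * a)) * (-(1 * a))) 1 :=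
      (((hasDerivAt_id (1 : ℝ)).mul_const a).neg).exp
    rw [hd.deriv]; ring_nf
  rw [locAct_of_loc (fun j _ => hmem _), actIn_pair_eq _ _ _ _ _ _ _ _ _ _ _ _ _ _ _ _ _ _ (show (0 : Fin 2) ≠ 1 by decide),
    if_pos hconn] at hmain
  simp only [hT, prod_singleton, hcard, slotFactor_inr, iteratedDeriv_one, hderiv, hext, interpForm_id_corner_pair] at hmain
  -- the two laws and the two expectations
  obtain ⟨v, hv⟩ : ∃ v : (BIJ88PolymerRep5134Gauss.Site (id : Fin 2 → Fin 2) ({0, 1} : Finset (Fin 2)) → ℝ) → ℝ,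
    v = fun ω => Real.exp (-(ω ⟨0, hmem 0⟩) ^ 2) := ⟨_, rfl⟩
  have hvfold : ∀ ω : BIJ88PolymerRep5134Gauss.Site (id : Fin 2 → Fin 2) ({0, 1} : Finset (Fin 2)) → ℝ,
    Real.exp (-(ω ⟨0, hmem 0⟩) ^ 2) = v ω := fun ω => by rw [hv]
  simp only [hvfold] at hmain
  haveI hP : ∀ Λ', IsProbabilityMeasure (regionLaw (id : Fin 2 → Fin 2) (!![2, 1; 1, 2] : Matrix (Fin 2) (Fin 2) ℝ) (0 : Fin 2 → ℝ)
      ({0, 1} : Finset (Fin 2)) Λ') := fun Λ' => isProbabilityMeasure_regionLaw _ _ _ hΔ _ Λ'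
  obtain ⟨hJ1, hJ0⟩ := integral_exp_neg_sq_coupled_decoupled
  simp only [hvfold] at hJ1 hJ0
  obtain ⟨hw1, hw0⟩ := sqrt_window
  have hv0 : ∀ ω, 0 < v ω := fun ω => by rw [hv]; exact Real.exp_pos _
  have hv1 : ∀ ω, v ω ≤ 1 := fun ω => by rw [hv]; exact Real.exp_le_one_iff.2 (neg_nonpos.2 (sq_nonneg _))
  have hvc : Continuous v := by rw [hv]; fun_prop
  have hgc : Continuous fun ω => -(K * v ω * Real.exp (-(K * v ω))) := by rw [hv]; fun_prop
  have hint : ∀ (μ : Measure (BIJ88PolymerRep5134Gauss.Site (id : Fin 2 → Fin 2) ({0, 1} : Finset (Fin 2)) → ℝ)) [IsProbabilityMeasure μ]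
      (g : _ → ℝ), Continuous g → (∀ ω, |g ω| ≤ K) → Integrable g μ := fun μ _ g hg hb =>
    (integrable_const K).mono' hg.aestronglyMeasurable (ae_of_all _ fun ω => by rw [Real.norm_eq_abs]; exact hb ω)
  have hKv : ∀ ω, 0 ≤ K * v ω ∧ K * v ω ≤ K := fun ω => ⟨by have := hv0 ω; positivity, mul_le_of_le_one_right hK0.le (hv1 ω)⟩
  have hbd : ∀ (a : ℝ) ω, 0 ≤ a → a ≤ 1 → |-(a * (K * v ω))| ≤ K := fun a ω ha ha1 => by
    rw [abs_neg, abs_of_nonneg (mul_nonneg ha (hKv ω).1)]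
    exact (mul_le_of_le_one_left (hKv ω).1 ha1).trans (hKv ω).2
  have hb1 : ∀ ω, |-(K * v ω * Real.exp (-(K * v ω)))| ≤ K := fun ω => by
    rw [mul_comm (K * v ω)]
    exact hbd _ ω (Real.exp_pos _).le (Real.exp_le_one_iff.2 (by linarith [(hKv ω).1]))
  have hb2 : ∀ ω, |-(K * v ω)| ≤ K := fun ω => by simpa only [one_mul] using hbd 1 ω zero_le_one le_rfl
  have hb3 : ∀ ω, |-(Real.exp (-K) * (K * v ω))| ≤ K := fun ω =>
    hbd _ ω (Real.exp_pos _).le (Real.exp_le_one_iff.2 (by linarith))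
  -- coupled: `∫ −Kve^{−Kv} ≥ −K ∫ v = −K √3/√7`
  have hlow : -(K * (Real.sqrt 3 / Real.sqrt 7)) ≤
      ∫ ω, -(K * v ω * Real.exp (-(K * v ω))) ∂(regionLaw (id : Fin 2 → Fin 2) (!![2, 1; 1, 2] : Matrix (Fin 2) (Fin 2) ℝ)
        (0 : Fin 2 → ℝ) ({0, 1} : Finset (Fin 2)) ({0, 1} : Finset (Fin 2))) := by
    rw [← hJ1, ← integral_const_mul, ← integral_neg]
    refine integral_mono (hint _ _ (by fun_prop) hb2) (hint _ _ hgc hb1) fun ω => ?_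
    have h1 : Real.exp (-(K * v ω)) ≤ 1 := Real.exp_le_one_iff.2 (by have := hv0 ω; nlinarith)
    have h2 : 0 ≤ K * v ω := by have := hv0 ω; positivity
    show -(K * v ω) ≤ -(K * v ω * Real.exp (-(K * v ω)))
    nlinarith
  -- decoupled: `∫ −Kve^{−Kv} ≤ −e^{−K} K ∫ v = −e^{−K} K √4/√8`
  have hupp : ∫ ω, -(K * v ω * Real.exp (-(K * v ω))) ∂(regionLaw (id : Fin 2 → Fin 2) (!![2, 1; 1, 2] : Matrix (Fin 2) (Fin 2) ℝ)
        (0 : Fin 2 → ℝ) ({0, 1} : Finset (Fin 2)) (∅ : Finset (Fin 2))) ≤ -(Real.exp (-K) * (K * (Real.sqrt 4 / Real.sqrt 8))) := by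
    rw [← hJ0, ← integral_const_mul, ← integral_const_mul, ← integral_neg]
    refine integral_mono (hint _ _ hgc hb1) (hint _ _ (by fun_prop) hb3) fun ω => ?_
    have h1 : Real.exp (-K) ≤ Real.exp (-(K * v ω)) := Real.exp_le_exp.2 (by have := hv1 ω; nlinarith)
    have h2 : 0 ≤ K * v ω := by have := hv0 ω; positivity
    show -(K * v ω * Real.exp (-(K * v ω))) ≤ -(Real.exp (-K) * (K * v ω))
    nlinarith
  -- the located exponent is `3/2`
  have himg : (univ : Finset Unit).image (cubeIn cube₀ ({0, 1} : Finset (Fin 2)) ∘ γ₀) = {0} := by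
    ext z
    simp only [mem_image, mem_univ, true_and, mem_singleton, Function.comp_apply]
    exact ⟨fun ⟨_, hz⟩ => hz.symm, fun hz => ⟨(), hz.symm⟩⟩
  have hsd : ((({0, 1} : Finset (Fin 2)) \ {0}).card : ℝ) = 1 := by rw [show (({0, 1} : Finset (Fin 2)) \ {0}) = {1} by ext z; fin_cases z <;> simp, card_singleton, Nat.cast_one]
  rw [himg, hsd, card_univ, Fintype.card_unit, Nat.cast_one] at hmain
  have hθpow : θ ^ ((1 : ℝ) + 1 / 2 * 1) ≤ 32 / 10 ^ 9 := by
    rw [Real.rpow_add hθ0, Real.rpow_one, show (1 : ℝ) / 2 * 1 = 1 / 2 by norm_num, ← Real.sqrt_eq_rpow]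
    have hs : Real.sqrt θ ≤ 32 / 10 ^ 4 := by
      rw [hθ, show (32 : ℝ) / 10 ^ 4 = Real.sqrt ((32 / 10 ^ 4) ^ 2) from (Real.sqrt_sq (by norm_num)).symm]
      exact Real.sqrt_le_sqrt (by norm_num)
    calc θ * Real.sqrt θ ≤ (1 / 10 ^ 5) * (32 / 10 ^ 4) := by rw [hθ] at hs ⊢; gcongr
      _ = 32 / 10 ^ 9 := by norm_num
  -- the activity is `≥ K((1−K)·0.707 − 0.6547) > 5·10⁻⁸`
  have heK1 : 1 - K ≤ Real.exp (-K) := by linarith [Real.add_one_le_exp (-K)]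
  have hact := (abs_le.1 (hmain.trans hθpow)).2
  have hJ0' : (707 : ℝ) / 1000 * (1 - K) ≤ Real.sqrt 4 / Real.sqrt 8 * Real.exp (-K) :=
    mul_le_mul hw0 heK1 (by rw [hK]; norm_num) (le_trans (by norm_num) hw0)
  rw [hK] at hact hJ0' hlow hupp heK1
  linarith

end Main

end Literature.MathematicalPhysics.QuantumFieldTheory.BalabanImbrieJaffe1984to88.BIJ88Ineq5144PairGradientWitness

end
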